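import Mathlib
import Summits.NavierStokesRegularity.NavierStokesRegularity.Theorems.WakeRatchetAdmissibleEternalBoundCritical
import HarnessLib

/-!
# The TERMINAL PROFILE of an admissible eternal solution exists: `e^{σ} W_n(σ) → r_n` as `σ → ∞`
# (support for `WakeRatchet.AdmissibleEternalBound`, stmt-NavierStokesRegularity-23197)

MODEL lattice ODEs only (Tao 2016 §4, §6.4); nothing in this file is a statement about the
Navier–Stokes equations, and no summit or rung is proved by it.

For an admissible eternal solution with covariant viscosity (`IsEternalVisc ε₀ ν̂ α W`, any `ν̂ ≥ 0`)
the critical variable `V_n(t) = (-t)⁻¹ W_n(-log(-t))` (`= Λ^n X_n(t)`, blow-up time `0`) solves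
`V̇_n = Q(V_n) + Λ A(V_{n-1}) + Λ⁻¹ B(V_{n+1}, V_n) − ν̂(1+ε₀)^{2n} V_n` on `t < 0`
(`hasDerivAt_crit_visc`; the viscosity coefficient becomes CONSTANT in physical time).  The forward
clause `bdd` of admissibility bounds `V_{n-1}, V_n, V_{n+1}` near `0⁻`, hence bounds `V̇_n` there, so
`V_n` is Lipschitz near `0⁻` and has a one-sided limit (`exists_tendsto_of_norm_deriv_le`, Cauchy
criterion).  Back in log-time:

* `exists_terminalProfile`: for every shell, `e^{σ} W_n(σ)` converges as `σ → ∞` — the physical state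
  `X_n(t⋆)` at the blow-up time exists shell by shell (the «residual» left behind by the cascade).

This discharges the convergence clause of the construction item `SymmetricBounceWaves` of the negative
lemma `WakeRatchetAdmissibleEternalBound/Negative/AdmissibleEternalBoundFalseOfSymmetricBounceWaves`:
only the symmetry `g r_n = r_n` of the terminal profile and the blow-up remain to be exhibited.
-/

noncomputable section

set_option linter.dupNamespace false

namespace Summit.NavierStokesRegularity.NavierStokesRegularity.Theorems

namespace WakeRatchetTerminal

open Filter Topology MeasureTheory Set
open scoped RealInnerProductSpace
open Literature.Analysis.FluidPDE Literature.Analysis.FluidPDE.TaoCascade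
open WakeRatchetCritical

variable {m : ℕ}

/-! ## Critical variables with covariant viscosity -/

/-- **Critical variables, viscous form.**  If shell `n` of `W` obeys the renormalised lattice law
with covariant viscosity `ν̂ (1+ε₀)^{2n} e^{-σ}` at `σ = -log(-t)` (`t < 0`), then
`V_k(t) := (-t)⁻¹ • W_k(-log(-t))` obeys the autonomous lattice with the CONSTANT viscosity
coefficient `ν̂ (1+ε₀)^{2n}` at `t`.
[cite: Tao2016AveragedNS, §4, the viscous equation displayed before Thm. 4.2, and §6.4; cell vocabulary (`IsEternalVisc`)] -/
theorem hasDerivAt_crit_visc {ε₀ νh : ℝ} {α : Fin m → Fin m → Fin m → ℤ × ℤ × ℤ → ℝ}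
    {W : ℤ → ℝ → Em m} {n : ℤ} {t : ℝ} (ht : t < 0)
    (hlaw : HasDerivAt (W n)
      (-((1 : ℝ) • W n (-Real.log (-t))) + tableQ α (W n (-Real.log (-t)))
        + bigLam ε₀ • tableA α (W (n - 1) (-Real.log (-t)))
        + (bigLam ε₀)⁻¹ • tableB α (W (n + 1) (-Real.log (-t))) (W n (-Real.log (-t)))
        - (νh * ((1 + ε₀) ^ ((2 : ℝ) * n) * Real.exp (-(-Real.log (-t))))) • W n (-Real.log (-t)))
      (-Real.log (-t))) :
    HasDerivAt (fun s : ℝ => (-s)⁻¹ • W n (-Real.log (-s)))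
      (tableQ α ((-t)⁻¹ • W n (-Real.log (-t)))
        + bigLam ε₀ • tableA α ((-t)⁻¹ • W (n - 1) (-Real.log (-t)))
        + (bigLam ε₀)⁻¹ • tableB α ((-t)⁻¹ • W (n + 1) (-Real.log (-t)))
            ((-t)⁻¹ • W n (-Real.log (-t)))
        - (νh * (1 + ε₀) ^ ((2 : ℝ) * n)) • ((-t)⁻¹ • W n (-Real.log (-t)))) t := by
  have hcomp := hlaw.scomp t (hasDerivAt_negLogNeg ht)
  have hprod := (hasDerivAt_invNeg ht).smul hcomp
  refine hprod.congr_deriv ?_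
  have hexp : Real.exp (-(-Real.log (-t))) = -t := by
    rw [neg_neg, Real.exp_log (neg_pos.2 ht)]
  rw [hexp]
  simp only [Function.comp_apply, tableQ_smul, tableA_smul, tableB_smul_smul, smul_add, smul_sub,
    smul_neg, smul_smul, one_smul]
  have ht0 : t ≠ 0 := by linarith
  have hc : (-t)⁻¹ * (νh * ((1 + ε₀) ^ ((2 : ℝ) * n) * -t)) = νh * (1 + ε₀) ^ ((2 : ℝ) * n) := by
    field_simp
  rw [show (-t)⁻¹ * ((-t)⁻¹ * (νh * ((1 + ε₀) ^ ((2 : ℝ) * n) * -t)))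
      = (-t)⁻¹ * (νh * (1 + ε₀) ^ ((2 : ℝ) * n)) by rw [hc]]
  module

/-! ## A function with bounded derivative on `[t₀, 0)` has a limit at `0⁻` -/

/-- Cauchy criterion: a function with derivative bounded by `C` on `[t₀, 0)` (`t₀ < 0`) is
`C`-Lipschitz there, hence converges as `t → 0⁻` (values in a complete space). [folklore] -/
theorem exists_tendsto_of_norm_deriv_le {E : Type*} [NormedAddCommGroup E] [NormedSpace ℝ E]
    [CompleteSpace E] {f f' : ℝ → E} {t₀ C : ℝ} (ht₀ : t₀ < 0)
    (hf : ∀ t ∈ Ico t₀ 0, HasDerivAt f (f' t) t) (hC : ∀ t ∈ Ico t₀ 0, ‖f' t‖ ≤ C) :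
    ∃ r : E, Tendsto f (𝓝[<] (0 : ℝ)) (𝓝 r) := by
  have hlip : ∀ x ∈ Ico t₀ 0, ∀ y ∈ Ico t₀ 0, ‖f y - f x‖ ≤ C * ‖y - x‖ := fun x hx y hy =>
    (convex_Ico t₀ 0).norm_image_sub_le_of_norm_hasDerivWithin_le
      (fun t ht => (hf t ht).hasDerivWithinAt) hC hx hy
  have hC0 : 0 ≤ C := le_trans (norm_nonneg _) (hC t₀ ⟨le_rfl, ht₀⟩)
  have hcauchy : Cauchy (map f (𝓝[<] (0 : ℝ))) := by
    rw [Metric.cauchy_iff]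
    refine ⟨Filter.map_neBot, fun ε hε => ?_⟩
    set δ : ℝ := min (-t₀) (ε / (2 * (C + 1))) with hδ
    have hδpos : 0 < δ := lt_min (by linarith) (by positivity)
    have hδ₁ : δ ≤ -t₀ := min_le_left _ _
    have hδ₂ : δ ≤ ε / (2 * (C + 1)) := min_le_right _ _
    refine ⟨f '' Ioo (-δ) 0, image_mem_map (Ioo_mem_nhdsLT (by linarith)), ?_⟩
    rintro x ⟨s, hs, rfl⟩ y ⟨u, hu, rfl⟩
    have hs' : s ∈ Ico t₀ 0 := ⟨by linarith [hs.1], hs.2⟩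
    have hu' : u ∈ Ico t₀ 0 := ⟨by linarith [hu.1], hu.2⟩
    have h1 := hlip u hu' s hs'
    have h2 : ‖s - u‖ ≤ δ := by
      rw [Real.norm_eq_abs, abs_le]; constructor <;> linarith [hs.1, hs.2, hu.1, hu.2]
    have h3 : C * ‖s - u‖ ≤ (C + 1) * δ := by nlinarith [norm_nonneg (s - u)]
    have h4 : (C + 1) * δ ≤ ε / 2 := by
      calc (C + 1) * δ ≤ (C + 1) * (ε / (2 * (C + 1))) := mul_le_mul_of_nonneg_left hδ₂ (by linarith)
        _ = ε / 2 := by field_simp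
    rw [dist_eq_norm]
    linarith
  obtain ⟨r, hr⟩ := CompleteSpace.complete hcauchy
  exact ⟨r, hr⟩

/-! ## The terminal profile -/

section Terminal

variable {ε₀ νh : ℝ} {α : Fin m → Fin m → Fin m → ℤ × ℤ × ℤ → ℝ} {W : ℤ → ℝ → Em m}

/-- From the forward clause `bdd`: the critical variable `V_k(t) = (-t)⁻¹ W_k(-log(-t))` is bounded on
some interval `[t₀, 0)`. [cite: Tao2016AveragedNS, §6.4; cell vocabulary (`IsEternalVisc.bdd`)] -/
theorem exists_norm_crit_le (hW : IsEternalVisc ε₀ νh α W) (k : ℤ) :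
    ∃ t₀ : ℝ, t₀ < 0 ∧ ∃ B : ℝ, ∀ t : ℝ, t₀ ≤ t → t < 0 →
      ‖(-t)⁻¹ • W k (-Real.log (-t))‖ ≤ B := by
  obtain ⟨σ₀, P, hP⟩ := hW.bdd k
  refine ⟨-Real.exp (-σ₀), neg_neg_iff_pos.2 (Real.exp_pos _), Real.sqrt P, fun t ht1 ht2 => ?_⟩
  have hnt : 0 < -t := neg_pos.2 ht2
  have hσ : σ₀ ≤ -Real.log (-t) := by
    have h1 : Real.log (-t) ≤ Real.log (Real.exp (-σ₀)) := Real.log_le_log hnt (by linarith)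
    rw [Real.log_exp] at h1
    linarith
  have hPt := hP _ hσ
  have hsq : (Real.exp (-Real.log (-t)) * ‖W k (-Real.log (-t))‖) ^ 2 ≤ P := by
    rw [mul_pow, ← Real.exp_nat_mul]; push_cast; exact hPt
  have hle : Real.exp (-Real.log (-t)) * ‖W k (-Real.log (-t))‖ ≤ Real.sqrt P := by
    rw [← Real.sqrt_sq (by positivity : 0 ≤ Real.exp (-Real.log (-t)) * ‖W k (-Real.log (-t))‖)]
    exact Real.sqrt_le_sqrt hsq
  rw [crit_eq_exp_smul (W k) ht2, norm_smul, Real.norm_eq_abs, abs_of_pos (Real.exp_pos _)]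
  exact hle

/-- **The terminal profile exists.**  For every admissible eternal solution with covariant viscosity
(`ν̂ ≥ 0` arbitrary) and every shell `n`, `e^{σ} W_n(σ)` converges as `σ → ∞`: the physical shell
state `X_n(t) = Λ^{-n} e^{σ} W_n(σ)` extends continuously to the blow-up time `t⋆`.
[cite: Tao2016AveragedNS, §4 Lemma 4.1 (4.8), the viscous equation before Thm. 4.2, §6.4; cell vocabulary (`IsEternalVisc`)] -/
theorem exists_terminalProfile (hW : IsEternalVisc ε₀ νh α W) (n : ℤ) :
    ∃ r : Em m, Tendsto (fun σ : ℝ => Real.exp σ • W n σ) atTop (𝓝 r) := by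
  -- bounds on the three shells near `0⁻`
  obtain ⟨t₁, ht₁, B₁, hB₁⟩ := exists_norm_crit_le hW (n - 1)
  obtain ⟨t₂, ht₂, B₂, hB₂⟩ := exists_norm_crit_le hW n
  obtain ⟨t₃, ht₃, B₃, hB₃⟩ := exists_norm_crit_le hW (n + 1)
  set t₀ : ℝ := max t₁ (max t₂ t₃) with ht₀def
  have ht₀ : t₀ < 0 := max_lt ht₁ (max_lt ht₂ ht₃)
  have h01 : t₁ ≤ t₀ := le_max_left _ _
  have h02 : t₂ ≤ t₀ := (le_max_left _ _).trans (le_max_right _ _)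
  have h03 : t₃ ≤ t₀ := (le_max_right _ _).trans (le_max_right _ _)
  set V : ℤ → ℝ → Em m := fun k t => (-t)⁻¹ • W k (-Real.log (-t)) with hV
  set c : ℝ := νh * (1 + ε₀) ^ ((2 : ℝ) * n) with hc
  set Λ : ℝ := bigLam ε₀ with hΛ
  -- the derivative of `V n` and its bound on `[t₀, 0)`
  set D : ℝ → Em m := fun t => tableQ α (V n t) + Λ • tableA α (V (n - 1) t)
    + Λ⁻¹ • tableB α (V (n + 1) t) (V n t) - c • V n t with hD
  have hder : ∀ t ∈ Ico t₀ 0, HasDerivAt (V n) (D t) t := by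
    intro t ht
    have h := hasDerivAt_crit_visc (ε₀ := ε₀) (νh := νh) (α := α) (W := W) (n := n) ht.2
      (hW.law n _)
    simpa only [hV, hD, hc, hΛ] using h
  set C : ℝ := shiftConst α (0, 0, 0) * B₂ ^ 2 + |Λ| * (shiftConst α (0, 0, 1) * B₁ ^ 2)
    + |Λ⁻¹| * ((shiftConst α (1, 0, 0) + shiftConst α (0, 1, 0)) * B₃ * B₂) + |c| * B₂ with hCdef
  have hbound : ∀ t ∈ Ico t₀ 0, ‖D t‖ ≤ C := by
    intro t ht
    have hb1 : ‖V (n - 1) t‖ ≤ B₁ := hB₁ t (h01.trans ht.1) ht.2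
    have hb2 : ‖V n t‖ ≤ B₂ := hB₂ t (h02.trans ht.1) ht.2
    have hb3 : ‖V (n + 1) t‖ ≤ B₃ := hB₃ t (h03.trans ht.1) ht.2
    have hB1 : 0 ≤ B₁ := (norm_nonneg _).trans hb1
    have hB2 : 0 ≤ B₂ := (norm_nonneg _).trans hb2
    have hB3 : 0 ≤ B₃ := (norm_nonneg _).trans hb3
    have hQ : ‖tableQ α (V n t)‖ ≤ shiftConst α (0, 0, 0) * B₂ ^ 2 :=
      (norm_tableQ_le α _).trans (mul_le_mul_of_nonneg_left
        (pow_le_pow_left₀ (norm_nonneg _) hb2 2) (shiftConst_nonneg α _))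
    have hA : ‖Λ • tableA α (V (n - 1) t)‖ ≤ |Λ| * (shiftConst α (0, 0, 1) * B₁ ^ 2) := by
      rw [norm_smul, Real.norm_eq_abs]
      exact mul_le_mul_of_nonneg_left ((norm_tableA_le α _).trans (mul_le_mul_of_nonneg_left
        (pow_le_pow_left₀ (norm_nonneg _) hb1 2) (shiftConst_nonneg α _))) (abs_nonneg _)
    have hB : ‖Λ⁻¹ • tableB α (V (n + 1) t) (V n t)‖
        ≤ |Λ⁻¹| * ((shiftConst α (1, 0, 0) + shiftConst α (0, 1, 0)) * B₃ * B₂) := by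
      rw [norm_smul, Real.norm_eq_abs]
      refine mul_le_mul_of_nonneg_left ((norm_tableB_le α _ _).trans ?_) (abs_nonneg _)
      have hs : 0 ≤ shiftConst α (1, 0, 0) + shiftConst α (0, 1, 0) :=
        add_nonneg (shiftConst_nonneg α _) (shiftConst_nonneg α _)
      calc (shiftConst α (1, 0, 0) + shiftConst α (0, 1, 0)) * ‖V (n + 1) t‖ * ‖V n t‖
          ≤ (shiftConst α (1, 0, 0) + shiftConst α (0, 1, 0)) * B₃ * ‖V n t‖ :=
            mul_le_mul_of_nonneg_right (mul_le_mul_of_nonneg_left hb3 hs) (norm_nonneg _)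
        _ ≤ (shiftConst α (1, 0, 0) + shiftConst α (0, 1, 0)) * B₃ * B₂ :=
            mul_le_mul_of_nonneg_left hb2 (mul_nonneg hs hB3)
    have hcV : ‖c • V n t‖ ≤ |c| * B₂ := by
      rw [norm_smul, Real.norm_eq_abs]
      exact mul_le_mul_of_nonneg_left hb2 (abs_nonneg _)
    calc ‖D t‖ ≤ ‖tableQ α (V n t) + Λ • tableA α (V (n - 1) t) + Λ⁻¹ • tableB α (V (n + 1) t) (V n t)‖
          + ‖c • V n t‖ := norm_sub_le _ _
      _ ≤ (‖tableQ α (V n t)‖ + ‖Λ • tableA α (V (n - 1) t)‖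
          + ‖Λ⁻¹ • tableB α (V (n + 1) t) (V n t)‖) + ‖c • V n t‖ := by
            gcongr; exact norm_add₃_le
      _ ≤ C := by rw [hCdef]; linarith
  -- the one-sided limit of `V n` at `0`
  obtain ⟨r, hr⟩ := exists_tendsto_of_norm_deriv_le ht₀ hder hbound
  refine ⟨r, ?_⟩
  -- back to log-time: `e^{σ} W_n(σ) = V_n(-e^{-σ})` and `-e^{-σ} → 0⁻`
  have hto : Tendsto (fun σ : ℝ => -Real.exp (-σ)) atTop (𝓝[<] (0 : ℝ)) := by
    refine tendsto_nhdsWithin_iff.2 ⟨?_, Filter.Eventually.of_forall fun σ => ?_⟩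
    · simpa using Real.tendsto_exp_neg_atTop_nhds_zero.neg
    · exact neg_neg_iff_pos.2 (Real.exp_pos _)
  refine (hr.comp hto).congr fun σ => ?_
  simp only [Function.comp_apply, hV, neg_neg, Real.log_exp]
  rw [Real.exp_neg, inv_inv]

end Terminal

end WakeRatchetTerminal

end Summit.NavierStokesRegularity.NavierStokesRegularity.Theorems
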